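/- Fleet lead `ym-wcr-19456-p1`, route `WeakCouplingRates`, crux `ColdBoxTwoPointFloorW` (stmt-QuantumFields-19608). -/
import Summits.QuantumFields.YangMills.Theorems.WeakCouplingRatesColdBoxChart
import Literature.MathematicalPhysics.QuantumLattice.SU2HaarSmallBallUpper

/-!
# Crux `ColdBoxTwoPointFloor(W)`, piece S3c-ii step 4 (chart): the CUBIC REMAINDER of the plaquette Wilson cost in the
# gnomonic chart — `|(2 − Re tr U_p) − ‖a+b+c+d‖²| ≤ 362·m³`

For four pure-imaginary quaternions `a, b, c, d` (the gnomonic chart coordinates `(1, vᵢ)` of the four links of a plaquette,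
reversed links entered as `−v` by `quatToSU2_gnomonicQuat_inv`; `U_p = P((1+a)(1+b)(1+c)(1+d))` by `quatToSU2_mul_quatToSU2`)
with `‖a‖,…,‖d‖ ≤ m ≤ 1/4`: **`abs_plaquetteCost_sub_sq_norm_le`** — the Wilson cost `2 − Re tr U_p` equals the squared norm of
the LINEAR circulation `a+b+c+d` up to `362·m³`.  With `t = √(2β)·v` this is the uniform Taylor input «`β·cost_p = ½|s(p)|² + O(β m³)`»
of the sup-norm step of stub `stub_boxDirichletDomination`/`stub_boxGaussianDomination`.
Ingredients: the expansion `(1+a)(1+b)(1+c)(1+d) = 1 + (a+b+c+d) + E` (`prod_one_add_eq`, `noncomm_ring`) with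
`‖E‖ ≤ 6m²+4m³+m⁴` (`norm_quadErr_le`, `ℍ` is a normed division ring); `‖im x‖ ≤ ‖x‖`, the tree's `abs_re_le_norm`; `‖1+a‖² = 1+‖a‖²` for pure
imaginary `a`; the cost identity `2 − Re tr P(q) = 2‖im q‖²/(‖q‖(‖q‖+re q))` (`…ColdBoxChart`); and a scalar endgame
(`cost_taylor_scalar`).  The only definition is the polynomial `quadErr`.  Everything proved; standard axioms.
-/

set_option autoImplicit false

noncomputable section

open Quaternion
open Literature.MathematicalPhysics.QuantumLattice

namespace Summit.QuantumFields.YangMills.Theorems.WeakCouplingRates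

/-! ### Quaternion norm facts -/

/-- `‖im x‖² = imI² + imJ² + imK²`. -/
theorem sq_norm_im (x : ℍ) : ‖x.im‖ ^ 2 = x.imI ^ 2 + x.imJ ^ 2 + x.imK ^ 2 := by
  rw [sq_norm_eq_sum_sq]; simp

/-- For a PURE IMAGINARY `a` (`re a = 0`): `‖1 + a‖² = 1 + ‖a‖²`. -/
theorem sq_norm_one_add_of_re_eq_zero {a : ℍ} (ha : a.re = 0) : ‖1 + a‖ ^ 2 = 1 + ‖a‖ ^ 2 := by
  rw [sq_norm_eq_sum_sq, sq_norm_eq_sum_sq a]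
  simp [ha]; ring

/-- For a pure imaginary `a` with `‖a‖ ≤ m`: `1 ≤ ‖1 + a‖ ≤ 1 + m²`. -/
theorem norm_one_add_bounds {a : ℍ} (ha : a.re = 0) {m : ℝ} (hm : ‖a‖ ≤ m) :
    1 ≤ ‖1 + a‖ ∧ ‖1 + a‖ ≤ 1 + m ^ 2 := by
  have h := sq_norm_one_add_of_re_eq_zero ha
  have hn := norm_nonneg (1 + a)
  have hm0 : 0 ≤ m := (norm_nonneg a).trans hm
  constructor
  · nlinarith [norm_nonneg a]
  · have : ‖a‖ ^ 2 ≤ m ^ 2 := pow_le_pow_left₀ (norm_nonneg a) hm 2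
    nlinarith

/-! ### The expansion `(1+a)(1+b)(1+c)(1+d) = 1 + (a+b+c+d) + E` and the size of `E` -/

/-- The higher-order part of the product of four perturbations of `1`. -/
def quadErr (a b c d : ℍ) : ℍ :=
  a * b + a * c + a * d + b * c + b * d + c * d + a * b * c + a * b * d + a * c * d + b * c * d + a * b * c * d

/-- The expansion identity. -/
theorem prod_one_add_eq (a b c d : ℍ) :
    (1 + a) * (1 + b) * (1 + c) * (1 + d) = 1 + (a + b + c + d) + quadErr a b c d := by
  simp only [quadErr]; noncomm_ring

/-- **Size of the higher-order part**: `‖E‖ ≤ 6m² + 4m³ + m⁴` if all four perturbations have norm `≤ m`. -/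
theorem norm_quadErr_le {a b c d : ℍ} {m : ℝ} (ha : ‖a‖ ≤ m) (hb : ‖b‖ ≤ m) (hc : ‖c‖ ≤ m) (hd : ‖d‖ ≤ m) :
    ‖quadErr a b c d‖ ≤ 6 * m ^ 2 + 4 * m ^ 3 + m ^ 4 := by
  have hm0 : 0 ≤ m := (norm_nonneg a).trans ha
  have h2 : ∀ x y : ℍ, ‖x‖ ≤ m → ‖y‖ ≤ m → ‖x * y‖ ≤ m ^ 2 := fun x y hx hy => by
    rw [norm_mul, sq]; exact mul_le_mul hx hy (norm_nonneg _) hm0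
  have h3 : ∀ x y z : ℍ, ‖x‖ ≤ m → ‖y‖ ≤ m → ‖z‖ ≤ m → ‖x * y * z‖ ≤ m ^ 3 := fun x y z hx hy hz => by
    rw [norm_mul, pow_succ]; exact mul_le_mul (h2 x y hx hy) hz (norm_nonneg _) (by positivity)
  have h4 : ‖a * b * c * d‖ ≤ m ^ 4 := by
    rw [norm_mul, pow_succ]; exact mul_le_mul (h3 a b c ha hb hc) hd (norm_nonneg _) (by positivity)
  unfold quadErr
  calc ‖a * b + a * c + a * d + b * c + b * d + c * d + a * b * c + a * b * d + a * c * d + b * c * d + a * b * c * d‖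
      ≤ ‖a * b‖ + ‖a * c‖ + ‖a * d‖ + ‖b * c‖ + ‖b * d‖ + ‖c * d‖ + ‖a * b * c‖ + ‖a * b * d‖ + ‖a * c * d‖ +
          ‖b * c * d‖ + ‖a * b * c * d‖ := by
        repeat (first | refine (norm_add_le _ _).trans (add_le_add ?_ le_rfl) | exact le_rfl)
    _ ≤ m ^ 2 + m ^ 2 + m ^ 2 + m ^ 2 + m ^ 2 + m ^ 2 + m ^ 3 + m ^ 3 + m ^ 3 + m ^ 3 + m ^ 4 := by
        gcongr
        · exact h2 a b ha hb
        · exact h2 a c ha hc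
        · exact h2 a d ha hd
        · exact h2 b c hb hc
        · exact h2 b d hb hd
        · exact h2 c d hc hd
        · exact h3 a b c ha hb hc
        · exact h3 a b d ha hb hd
        · exact h3 a c d ha hc hd
        · exact h3 b c d hb hc hd
    _ = 6 * m ^ 2 + 4 * m ^ 3 + m ^ 4 := by ring

/-! ### The cubic remainder of the plaquette cost -/

/-- Scalar endgame of the Taylor estimate. -/
theorem cost_taylor_scalar {I s ε n r m : ℝ} (hm0 : 0 ≤ m) (hm : m ≤ 1 / 4) (hs0 : 0 ≤ s) (hs : s ≤ 4 * m)
    (hI0 : 0 ≤ I) (hIs : |I - s| ≤ ε) (hε : ε ≤ 11 * m ^ 2) (hn1 : 1 ≤ n) (hn2 : n ≤ 1 + 5 * m ^ 2)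
    (hr : |r - 1| ≤ ε) :
    |2 * I ^ 2 / (n * (n + r)) - s ^ 2| ≤ 362 * m ^ 3 := by
  have hε0 : 0 ≤ ε := (abs_nonneg _).trans hIs
  have hm2 : m ^ 2 ≤ m / 4 := by nlinarith
  have hr' := abs_le.1 hr
  have hIs' := abs_le.1 hIs
  set D := n * (n + r) with hD
  have hD1 : 1 ≤ D := by rw [hD]; nlinarith
  have hD2 : D ≤ 2 + 31 * m ^ 2 := by
    rw [hD]
    have h1 : n + r ≤ 2 + 16 * m ^ 2 := by linarith
    have h2 : n * (n + r) ≤ (1 + 5 * m ^ 2) * (2 + 16 * m ^ 2) :=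
      mul_le_mul hn2 h1 (by linarith) (by positivity)
    have h3 : m ^ 4 ≤ m ^ 2 / 16 := by nlinarith [sq_nonneg m]
    nlinarith
  have hD3 : 2 - 11 * m ^ 2 ≤ D := by rw [hD]; nlinarith
  have hD0 : 0 < D := by linarith
  -- |I² − s²| ≤ ε (2s + ε) ≤ 119 m³
  have hI2 : |I ^ 2 - s ^ 2| ≤ 119 * m ^ 3 := by
    have h1 : |I ^ 2 - s ^ 2| = |I - s| * |I + s| := by rw [← abs_mul]; ring_nf
    rw [h1]
    have h2 : |I + s| ≤ 2 * s + ε := by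
      rw [abs_le]; constructor <;> linarith
    calc |I - s| * |I + s| ≤ ε * (2 * s + ε) := mul_le_mul hIs h2 (abs_nonneg _) hε0
      _ ≤ 11 * m ^ 2 * (8 * m + 11 * m ^ 2) := by
          apply mul_le_mul hε (by linarith) (by linarith) (by positivity)
      _ ≤ 119 * m ^ 3 := by nlinarith
  -- endgame
  have hkey : 2 * I ^ 2 / D - s ^ 2 = (2 * (I ^ 2 - s ^ 2) + s ^ 2 * (2 - D)) / D := by
    field_simp; ring
  rw [hkey, abs_div, abs_of_pos hD0, div_le_iff₀ hD0]
  have hs2 : s ^ 2 ≤ 16 * m ^ 2 := by nlinarith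
  have hDm : |2 - D| ≤ 31 * m ^ 2 := by rw [abs_le]; constructor <;> linarith
  calc |2 * (I ^ 2 - s ^ 2) + s ^ 2 * (2 - D)| ≤ 2 * |I ^ 2 - s ^ 2| + s ^ 2 * |2 - D| := by
        have := abs_add_le (2 * (I ^ 2 - s ^ 2)) (s ^ 2 * (2 - D))
        rw [abs_mul, abs_mul, abs_of_pos (by norm_num : (0 : ℝ) < 2), abs_of_nonneg (sq_nonneg s)] at this
        exact this
    _ ≤ 2 * (119 * m ^ 3) + 16 * m ^ 2 * (31 * m ^ 2) := by
        gcongr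
    _ ≤ 362 * m ^ 3 := by nlinarith [pow_nonneg hm0 3]
    _ ≤ 362 * m ^ 3 * D := le_mul_of_one_le_right (by positivity) hD1

/-- **The cubic remainder of the plaquette cost in the gnomonic chart.**  For four PURE IMAGINARY quaternions
`a, b, c, d` (chart coordinates of the four links of a plaquette, reversed links entered as `−v`) of norm `≤ m ≤ 1/4`,
the Wilson cost of the projected product `U_p = P((1+a)(1+b)(1+c)(1+d))` satisfies
`|(2 − Re tr U_p) − ‖a + b + c + d‖²| ≤ 362·m³` — the plaquette cost is the squared (linear) circulation up to a cubic error,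
uniformly; with `t = √(2β)·v` this is the input «`β·cost_p = ½|s(p)|² + O(β·m³)`» of the one-scale expansion. -/
theorem abs_plaquetteCost_sub_sq_norm_le {a b c d : ℍ} (ha0 : a.re = 0) (hb0 : b.re = 0) (hc0 : c.re = 0)
    (hd0 : d.re = 0) {m : ℝ} (hm : m ≤ 1 / 4) (ha : ‖a‖ ≤ m) (hb : ‖b‖ ≤ m) (hc : ‖c‖ ≤ m) (hd : ‖d‖ ≤ m) :
    |(2 - (((quatToSU2 ((1 + a) * (1 + b) * (1 + c) * (1 + d)) : Matrix.specialUnitaryGroup (Fin 2) ℂ) :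
        Matrix (Fin 2) (Fin 2) ℂ).trace).re) - ‖a + b + c + d‖ ^ 2| ≤ 362 * m ^ 3 := by
  have hm0 : 0 ≤ m := (norm_nonneg a).trans ha
  have hm1 : m ≤ 1 := by linarith
  set q : ℍ := (1 + a) * (1 + b) * (1 + c) * (1 + d) with hq
  set S : ℍ := a + b + c + d with hSdef
  set E : ℍ := quadErr a b c d with hEdef
  have hqE : q = 1 + S + E := prod_one_add_eq a b c d
  -- sizes
  have hE : ‖E‖ ≤ 11 * m ^ 2 := by
    have h := norm_quadErr_le ha hb hc hd
    have : 4 * m ^ 3 + m ^ 4 ≤ 5 * m ^ 2 := by nlinarith [pow_nonneg hm0 2, pow_nonneg hm0 3]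
    linarith
  have hS : ‖S‖ ≤ 4 * m := by
    calc ‖S‖ ≤ ‖a + b + c‖ + ‖d‖ := norm_add_le _ _
      _ ≤ ‖a + b‖ + ‖c‖ + ‖d‖ := by gcongr; exact norm_add_le _ _
      _ ≤ ‖a‖ + ‖b‖ + ‖c‖ + ‖d‖ := by gcongr; exact norm_add_le _ _
      _ ≤ 4 * m := by linarith
  have hSre : S.re = 0 := by simp [hSdef, ha0, hb0, hc0, hd0]
  have hSim : S.im = S := by
    have := Quaternion.re_add_im S
    rw [hSre] at this; simpa using this
  -- real and imaginary parts of q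
  have hqre : q.re = 1 + E.re := by
    rw [hqE]; simp [hSre]
  have hqim : q.im = S + E.im := by
    rw [hqE, Quaternion.im_add, Quaternion.im_add, hSim]
    simp
  have hr : |q.re - 1| ≤ ‖E‖ := by
    rw [hqre, add_sub_cancel_left]; exact Literature.MathematicalPhysics.QuantumLattice.abs_re_le_norm E
  have hIs : |‖q.im‖ - ‖S‖| ≤ ‖E‖ := by
    calc |‖q.im‖ - ‖S‖| ≤ ‖q.im - S‖ := abs_norm_sub_norm_le _ _
      _ = ‖E.im‖ := by rw [hqim, add_sub_cancel_left]
      _ ≤ ‖E‖ := by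
          have h1 := sq_norm_im E
          have h2 := sq_norm_eq_sum_sq E
          nlinarith [norm_nonneg E, norm_nonneg E.im, sq_nonneg E.re]
  -- the norm of q
  have hna := norm_one_add_bounds ha0 ha
  have hnb := norm_one_add_bounds hb0 hb
  have hnc := norm_one_add_bounds hc0 hc
  have hnd := norm_one_add_bounds hd0 hd
  have hnq : ‖q‖ = ‖1 + a‖ * ‖1 + b‖ * ‖1 + c‖ * ‖1 + d‖ := by
    rw [hq, norm_mul, norm_mul, norm_mul]
  have hn1 : 1 ≤ ‖q‖ := by
    rw [hnq]
    have h12 : 1 ≤ ‖1 + a‖ * ‖1 + b‖ := one_le_mul_of_one_le_of_one_le hna.1 hnb.1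
    have h123 : 1 ≤ ‖1 + a‖ * ‖1 + b‖ * ‖1 + c‖ := one_le_mul_of_one_le_of_one_le h12 hnc.1
    exact one_le_mul_of_one_le_of_one_le h123 hnd.1
  have hn2 : ‖q‖ ≤ 1 + 5 * m ^ 2 := by
    rw [hnq]
    have h4 : ‖1 + a‖ * ‖1 + b‖ * ‖1 + c‖ * ‖1 + d‖ ≤ (1 + m ^ 2) ^ 4 := by
      have := mul_le_mul (mul_le_mul (mul_le_mul hna.2 hnb.2 (by positivity) (by positivity)) hnc.2
        (by positivity) (by positivity)) hnd.2 (by positivity) (by positivity)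
      calc _ ≤ (1 + m ^ 2) * (1 + m ^ 2) * (1 + m ^ 2) * (1 + m ^ 2) := this
        _ = (1 + m ^ 2) ^ 4 := by ring
    have h5 : (1 + m ^ 2) ^ 4 ≤ 1 + 5 * m ^ 2 := by
      have hu0 : 0 ≤ m ^ 2 := sq_nonneg m
      have hu : m ^ 2 ≤ 1 / 16 := by nlinarith
      have e : (1 + m ^ 2) ^ 4 = 1 + 4 * m ^ 2 + 6 * (m ^ 2) ^ 2 + 4 * (m ^ 2) ^ 3 + (m ^ 2) ^ 4 := by ring
      have h2' : (m ^ 2) ^ 2 ≤ m ^ 2 / 16 := by nlinarith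
      have h3' : (m ^ 2) ^ 3 ≤ m ^ 2 / 256 := by nlinarith
      have h4' : (m ^ 2) ^ 4 ≤ m ^ 2 / 4096 := by nlinarith
      linarith
    linarith
  have hq0 : q ≠ 0 := by
    intro h; rw [h, norm_zero] at hn1; linarith
  have hden : ‖q‖ + q.re ≠ 0 := by
    have h1 := (abs_le.1 hr).1
    have : 11 * m ^ 2 ≤ 11 / 16 := by nlinarith
    intro h0; linarith
  -- the cost formula and the scalar endgame
  rw [two_sub_trace_re_quatToSU2_eq_imSq hq0 hden, ← sq_norm_im]
  exact cost_taylor_scalar hm0 hm (norm_nonneg S) hS (norm_nonneg _) hIs hE hn1 hn2 hr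

end Summit.QuantumFields.YangMills.Theorems.WeakCouplingRates

end
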